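/-
Copyright (c) 2026 the pub-hodgecm-mathlib formalisation cell (harness21).  Prover seat hodgecm-mathlib-LH4-p11 (g9), req620 Track A «(D-RAM) FOUR-FRAME» squad, helper lane on
h413 = stmt-HodgeConjecture-24833 (count-neutral).  β-BOARD v1 ROW R6a «THE κ-CLASS OF TOWER 1» — THE STRATUM HEAD `hκ₁` (β chair F0P3a-p01 (g37) LEDGER #16∕#18; the `hκ` binder of
★ p861954 `kappaLine_G1_of_rows` and the `hG1` binder of ★ p862092 `kappaLine_G3_of_G1`, LH4-p07 (g10)).  2026-09-04.
-/
import Summits.HodgeConjecture.HodgeConjecture.Theorems.F0P3cDyRamLabelledOddKappaClassG1Orbits   -- ★ FILE E1 (this seat): representatives, decomposition, slot-2 value; brings ★ p861894 FILE C, ★ FILE D, ★ p861967, ★ p861907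
import Summits.HodgeConjecture.HodgeConjecture.Theorems.F0P3cDyRamKappaClassFootSums             -- ★ p861882 (LH4-p08 (g10)): the orbit sums in the currency `C∕g`
import Summits.HodgeConjecture.HodgeConjecture.Theorems.F0P3cDyRamElementDatumParity             -- ★: `depth_mod_two_eq_of_isElementDatum`
import HarnessLib

/-!
# Crux `H413`, line LH4 «(D-RAM) FOUR-FRAME» — (β-BAL) Stage B, β-BOARD ROW R6a: THE TOWER-1 κ-CLASS STRATUM HEAD `hκ₁`
# `Σᶠ_{G₁(ρ,s), shell} m^Λ_i ∕ [𝒰:N(S̃′)] = (ω(e_A), 0, 0)_i ∕ 2 · q^{2ρ−1+s∕2} · ((q−1)·[2d + ℓ₀ + 2ρ + s ≤ n₁] − [n₁ + 2 = 2d + ℓ₀ + 2ρ + s])` on `2ρ + ℓ₀ = n₂`, `2ρ + s + ℓ₀ < n₁`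

Cell `hodgecm-mathlib` (D-0151), FLOOR 0, crux item H413 = `stmt-HodgeConjecture-24833`, route `HCCMUnconditional`; squad F0∕P3c∕LH4.  THEOREMS ONLY (no `def`, no instance, no
notation, no `sorry`, default heartbeats); ★-only imports; lane `--supports stmt-HodgeConjecture-24833 --as helper` (count-neutral); pays NO row, states NO law.

WHAT.  On the κ-branch of tower 1 (`2ρ + ℓ₀ = n₂`, `n₁ = 2(ρ+t′+k) + ℓ₀`, `s = 2t′`, `k ≥ 1`) the clean-shell cut of the stratum `G₁ = (2ρ, 2ρ+s, 2ρ+s)` decomposes over the glued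
representatives `latt V(1,1,g)` (★ FILE E1), whose per-orbit labelled odd values are (★ p861894, ★ FILE E1 §3; `C = e_B·π₀^{t′+k}∕e_A`, `|C∕g| = |ϖ|^{2k}`)
`ω(e_A)·ω(1 + C∕g)∕2·[2d ≤ ρ+2k+1]·w`, `ω(e_A)ω(g)ω(1 + C∕g)∕2·[2d ≤ ρ+1]·w`, `ω(−1)ω(e_A)ω(g)ω(1+g)ω(1 + C∕g)∕2·[2d ≤ ρ+1]·w`, with the constant weight
`w = ([(q−1)q^{⌈(ρ+2t′)∕2⌉−1}]·[(q−1)q^{ρ−1}])⁻¹` (★ `stabiliserWeight_latt_glued_tube_eq`) and the orbit mass ★ `orbit_mass_eq_pow`.  The orbit sums over a complete irredundant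
system `R` (`#R = (q−1)q^{⌈ρ∕2⌉−1}`, ★ (iv-c)) are LH4-p08 (g10)'s ★ p861882: `Σ ω(1 + C∕g) = #R ∕ −q^{⌈ρ∕2⌉−1} ∕ 0` (deep `2d ≤ 2k` ∕ boundary `k + 1 = d` ∕ below, in the
window), `Σ ω(g)ω(1 + C∕g) = 0` and `Σ ω(g)ω(1+g)ω(1 + C∕g) = 0` in the window `2d ≤ ρ + 1`.  Hence
§1 `value_latt_glued_rep_kappaLocus_eq` (the three per-orbit values, fed with ★ FILE E1's kit), §2 `card_mul_sum_value_{zero,one,two}_eq` (the class sums), and §3 THE HEAD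
**`finsum_stratum_G1_kappaLocus_shell_labelledOdd_div_relIndex_eq`** = ★ p861954's `hκ` (k = 1) binder VERBATIM, closed over the datum and the tokens `e_A` (of `α − 1` at `n₂`)
and `e_B` (of `β − 1` at `n₁`) — the `hG1` binder of ★ p862092 ∕ ★ p862074-style transports.  `2k = n₁ − n₂ − s`: the bracket is `(q−1)·[2d ≤ 2k] − [2k + 2 = 2d]`.
HONEST LABEL.  Count-neutral (`--supports`); nothing printed is asserted; hRest, (β) `stub_law_cleanSgn`, T₊ remain OPEN; `HC_CM` is proved only modulo the 7 printed citations
(2 remaining named inputs: hLiu418 = `stmt-HodgeConjecture-24832`, h413 = `stmt-HodgeConjecture-24833`) until rung 0 closes.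
References: [Kottwitz1986BaseChangeUnits] §1 pp. 240–241 · [Rogawski1990] §4.9 Prop. 4.9.1 (a)(b) p. 55, §4.10 p. 58 · [LanglandsShelstad1987] §3 · [Serre1979] Ch. V §3 Cor. 3, Ch. XV §2.
-/

set_option autoImplicit false

noncomputable section

namespace Summit.HodgeConjecture.HodgeConjecture.Cruxes.H413.F0P3cDyRamLabelledOddKappaClassG1

open Matrix WithZero
open Literature.NumberTheory.Automorphic Literature.NumberTheory.Automorphic.HermitianLattice Literature.NumberTheory.Automorphic.UnitaryGroup
open Literature.NumberTheory.Automorphic.UnitaryLatticeTree Literature.NumberTheory.Automorphic.UnitaryThreeFourFrame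
open Literature.NumberTheory.LocalFields Literature.NumberTheory.LocalFields.WildQuadraticDatum
open Summit.HodgeConjecture.HodgeConjecture.Cruxes.H413.F0P3cDyRamFourFramePieces
open Summit.HodgeConjecture.HodgeConjecture.Cruxes.H413.F0P3cDyRamFourFrameCensusDefs
open Summit.HodgeConjecture.HodgeConjecture.Cruxes.H413.F0P3cDyRamStageOneBDefs (mcOfRecord)
open Summit.HodgeConjecture.HodgeConjecture.Cruxes.H413.F0P3cDyRamStageOneBDerivedDefs (n0DerivedOfRecord mcOfRecord_le_n0DerivedOfRecord)
open Summit.HodgeConjecture.HodgeConjecture.Cruxes.H413.F0P3cDyRamDiagonalTorusDefs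
open Summit.HodgeConjecture.HodgeConjecture.Cruxes.H413.F0P3cDyRamDiagonalStrataDefs
open Summit.HodgeConjecture.HodgeConjecture.Cruxes.H413.F0P3cDyRamDiagonalKappaCountDefs
open Summit.HodgeConjecture.HodgeConjecture.Cruxes.H413.F0P3cDyRamLabelledOddCountDefs
open Summit.HodgeConjecture.HodgeConjecture.Cruxes.H413.F0P3cDyRamStableCountTypeZero (v_diag_eq_one diag_regular)
open Summit.HodgeConjecture.HodgeConjecture.Cruxes.H413.F0P3cDyRamDiagonalOrbitFibreCountHeads (finite_unitTorus_orbit_of_mem_normalisedStableLattices)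
open Summit.HodgeConjecture.HodgeConjecture.Cruxes.H413.F0P3cDyRamDiagonalGluedStabiliserIndex (stabiliserWeight_latt_glued_tube_eq ne_zero_and_v_lt_one_of_v_eq_exp)
open Summit.HodgeConjecture.HodgeConjecture.Cruxes.H413.F0P3cDyRamDiagonalGluedTorusOrbits (exists_gl_coe_eq_glued)
open Summit.HodgeConjecture.HodgeConjecture.Cruxes.H413.F0P3cDyRamDiagonalGluedClassRepresentatives (exists_fixed_class_representatives)
open Summit.HodgeConjecture.HodgeConjecture.Cruxes.H413.F0P3cDyRamDiagonalKappaGluedDecomposition (orbit_mass_eq_pow)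
open Summit.HodgeConjecture.HodgeConjecture.Cruxes.H413.F0P3cDyRamElementDatumParity (depth_mod_two_eq_of_isElementDatum)
open Summit.HodgeConjecture.HodgeConjecture.Cruxes.H413.F0P3cDyRamDiagonalKappaCoreHangingClass (two_le_d_of_v_two_lt_one)
open Summit.HodgeConjecture.HodgeConjecture.Cruxes.H413.F0P3cDyRamLabelledOddOffFootShellG1 (shell_iff_of_mem_stratum_G1_offFoot)
open Summit.HodgeConjecture.HodgeConjecture.Cruxes.H413.F0P3cDyRamLabelledOddKappaClassValueG1Slots
open Summit.HodgeConjecture.HodgeConjecture.Cruxes.H413.F0P3cDyRamLabelledOddKappaClassG1Orbits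
open Summit.HodgeConjecture.HodgeConjecture.Cruxes.H413.F0P3cDyRamKappaClassFootSums
open scoped Valued WithZero Matrix MatrixGroups

variable {K : Type} [Field K] [Valued K ℤᵐ⁰] [CompleteSpace K] [Fintype 𝓀[K]] {σ : K →+* K} {ϖ : K} {d t : ℕ} {α β : K} {N₀ n₁ n₂ n₃ : ℕ}

/-! ## §1  The three per-orbit values on the κ-branch, fed with the orbit kit -/

open Classical in
/-- **THE PER-ORBIT VALUES OF THE κ-CLASS, ALL THREE SLOTS** (★ p861894 slots `0`, `1` and ★ FILE E1 slot `2`, fed with ★ FILE E1 §1–§2: the representative is in the stratum, stable, on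
the clean shell (★ p861967), normalised, its orbit finite): with `r = e_B·π₀^{t′+k}∕(g·e_A)`,
`value₀ = ω(e_A(1+r))∕2·[2d ≤ ρ+2k+1]·w`, `value₁ = ω(g·e_A(1+r))∕2·[2d ≤ ρ+1]·w`, `value₂ = ω(g·e_A(1+r))·ω(−1)ω(1+g)∕2·[2d ≤ ρ+1]·w`.
[cite: Kottwitz1986BaseChangeUnits, §1 pp. 240–241] [cite: Rogawski1990, §4.9 Prop. 4.9.1 (b) p. 55] [cite: LanglandsShelstad1987, §3] -/
theorem value_latt_glued_rep_kappaLocus_eq (h2 : Valued.v (2 : K) < 1) (hD : IsRamifiedQuadraticDatum σ ϖ d t)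
    (hE : IsElementDatum σ ϖ N₀ α β n₁ n₂ n₃) (hmc : mcOfRecord d ≤ N₀)
    (T : GL (Fin 3) K) (hT : (T : Matrix (Fin 3) (Fin 3) K) = Matrix.diagonal ![α, β, 1]) (ρ t' : ℕ) (hρ : 1 ≤ ρ) (ht' : 1 ≤ t')
    (hloc : 2 * ρ + d % 2 = n₂) (k : ℕ) (hk : 1 ≤ k) (hk₁ : 2 * (ρ + t' + k) + d % 2 = n₁)
    {g : K} (hσg : σ g = g) (hg : Valued.v g = Valued.v ϖ ^ (2 * t'))
    (V : GL (Fin 3) K) (hV : (V : Matrix (Fin 3) (Fin 3) K) = !![1, 0, 0; 1, ϖ ^ ρ, 0; 1 * 1 + g, ϖ ^ ρ * 1, ϖ ^ (2 * ρ + 2 * t')])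
    {eA : K} (hσeA : σ eA = eA) (heA1 : Valued.v eA = 1)
    (heA : Valued.v ((ϖ ^ (d % 2 + 2 * d - 1))⁻¹ * ((α - 1) * ((ϖ * σ ϖ) ^ ρ)⁻¹ - eA * ((ϖ - σ ϖ) * ((ϖ * σ ϖ) ^ ((d - d % 2) / 2))⁻¹))) ≤ 1)
    {eB : K} (hσeB : σ eB = eB) (heB1 : Valued.v eB = 1)
    (heB : Valued.v ((ϖ ^ (d % 2 + 2 * d - 1))⁻¹ * ((β - 1) * ((ϖ * σ ϖ) ^ (ρ + t' + k))⁻¹ - eB * ((ϖ - σ ϖ) * ((ϖ * σ ϖ) ^ ((d - d % 2) / 2))⁻¹))) ≤ 1) :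
    ((labelledOddCount σ ϖ 0 0 (valueClassLabel σ ϖ (α - 1) (β - 1) (d % 2 + 2 * d - 1) d) (latt (V : Matrix (Fin 3) (Fin 3) K)) : ℚ) /
        ((((unitStabilizer (latt (V : Matrix (Fin 3) (Fin 3) K))).map (unitNormMap σ 3)).relIndex (fixedUnitTorus σ 3) : ℕ) : ℚ) =
      (normSign σ (eA * (1 + eB * (ϖ * σ ϖ) ^ (t' + k) / (g * eA))) : ℚ) / 2 *
        ((if 2 * d ≤ ρ + 2 * k + 1 then 1 else 0 : ℤ) : ℚ) * stabiliserWeight σ (latt (V : Matrix (Fin 3) (Fin 3) K))) ∧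
    ((labelledOddCount σ ϖ 0 1 (valueClassLabel σ ϖ (α - 1) (β - 1) (d % 2 + 2 * d - 1) d) (latt (V : Matrix (Fin 3) (Fin 3) K)) : ℚ) /
        ((((unitStabilizer (latt (V : Matrix (Fin 3) (Fin 3) K))).map (unitNormMap σ 3)).relIndex (fixedUnitTorus σ 3) : ℕ) : ℚ) =
      (normSign σ (g * eA * (1 + eB * (ϖ * σ ϖ) ^ (t' + k) / (g * eA))) : ℚ) / 2 *
        ((if 2 * d ≤ ρ + 1 then 1 else 0 : ℤ) : ℚ) * stabiliserWeight σ (latt (V : Matrix (Fin 3) (Fin 3) K))) ∧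
    ((labelledOddCount σ ϖ 0 2 (valueClassLabel σ ϖ (α - 1) (β - 1) (d % 2 + 2 * d - 1) d) (latt (V : Matrix (Fin 3) (Fin 3) K)) : ℚ) /
        ((((unitStabilizer (latt (V : Matrix (Fin 3) (Fin 3) K))).map (unitNormMap σ 3)).relIndex (fixedUnitTorus σ 3) : ℕ) : ℚ) =
      (normSign σ (g * eA * (1 + eB * (ϖ * σ ϖ) ^ (t' + k) / (g * eA))) : ℚ) * ((normSign σ (-1 : K) : ℚ) * (normSign σ (1 + g) : ℚ)) / 2 *
        ((if 2 * d ≤ ρ + 1 then 1 else 0 : ℤ) : ℚ) * stabiliserWeight σ (latt (V : Matrix (Fin 3) (Fin 3) K))) := by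
  haveI : Finite 𝓀[K] := Finite.of_fintype _
  have hd2 : 2 ≤ d := two_le_d_of_v_two_lt_one hD h2
  obtain ⟨-, hvσ, hϖ, -, -, -, -⟩ := id hD
  have hgt : 2 * ρ + 2 * t' + d % 2 < n₁ := by omega
  obtain ⟨hstab, hM⟩ := latt_glued_rep_mem_stratum_kappaLocus hD hE T hT ρ t' hρ ht' hloc hgt hσg hg V hV
  obtain ⟨hlev, hnlev, hsq⟩ := (shell_iff_of_mem_stratum_G1_offFoot hD hE hmc T ρ (2 * t') hρ (by omega) (by omega) _ hM).2 (Or.inr ⟨hloc, hgt⟩)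
  have hfin := finite_unitTorus_orbit_of_mem_normalisedStableLattices hϖ (v_diag_eq_one hvσ hE) (diag_regular hE) T hT hM.1
  exact ⟨labelledOddCount_div_relIndex_glued_rep_kappaLocus_zero hD h2 hd2 hE hmc hT hρ ht' hσg hg V hV hM.1.2.2 hstab hlev hnlev hsq hfin hloc k hk hk₁
      hσeA heA1 heA hσeB heB1 heB,
    labelledOddCount_div_relIndex_glued_rep_kappaLocus_one hD h2 hd2 hE hmc hT hρ ht' hσg hg V hV hM.1.2.2 hstab hlev hnlev hsq hfin hloc k hk hk₁
      hσeA heA1 heA hσeB heB1 heB,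
    labelledOddCount_div_relIndex_glued_rep_kappaLocus_two hD h2 hd2 hE hmc hT hρ ht' hσg hg V hV hM.1.2.2 hstab hlev hnlev hsq hfin hloc k hk hk₁
      hσeA heA1 heA hσeB heB1 heB⟩

omit [CompleteSpace K] [Fintype 𝓀[K]] in
/-- **THE CONSTANT `C = e_B·π₀^{t′+k}∕e_A` IS FIXED OF VALUATION `|ϖ|^{2t′}·|ϖ|^{2k}`** (`π₀ = ϖσϖ`, `|e_A| = |e_B| = 1`). [cite: Serre1979, Ch. V §3 Cor. 3] -/
theorem charConst_tokens (hD : IsRamifiedQuadraticDatum σ ϖ d t) (t' k : ℕ)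
    {eA : K} (hσeA : σ eA = eA) (heA1 : Valued.v eA = 1) {eB : K} (hσeB : σ eB = eB) (heB1 : Valued.v eB = 1) :
    σ (eB * (ϖ * σ ϖ) ^ (t' + k) / eA) = eB * (ϖ * σ ϖ) ^ (t' + k) / eA ∧
    Valued.v (eB * (ϖ * σ ϖ) ^ (t' + k) / eA) = Valued.v ϖ ^ (2 * t') * Valued.v ϖ ^ (2 * k) := by
  obtain ⟨hσ, hvσ, -, -, -, -, -⟩ := id hD
  refine ⟨by rw [map_div₀, map_mul, hσeB, map_pow, map_mul, hσ, mul_comm (σ ϖ) ϖ, hσeA], ?_⟩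
  rw [map_div₀, map_mul, heB1, one_mul, heA1, div_one, map_pow, map_mul, hvσ, ← pow_two, ← pow_mul, ← pow_add]
  congr 1; ring

/-- **THE ORBIT CHARACTER TOKENS**: with `C = e_B·π₀^{t′+k}∕e_A` and `g` fixed of valuation `|ϖ|^{2t′}` (`k ≥ 1`): `r(g) = e_B·π₀^{t′+k}∕(g·e_A) = C∕g`, `σ C = C`,
`|C| = |ϖ|^{2t′}·|ϖ|^{2k}`, and `ω(e_A·(1 + C∕g)) = ω(e_A)·ω(1 + C∕g)`, `ω(g·e_A·(1 + C∕g)) = ω(e_A)·(ω(g)·ω(1 + C∕g))` (★ `normSign_mul_of_fixed`; `1 + C∕g` is a fixed one-unit).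
[cite: Serre1979, Ch. V §3 Cor. 3; Ch. XV §2] -/
theorem orbitChar_tokens (hD : IsRamifiedQuadraticDatum σ ϖ d t) {t' k : ℕ} (hk : 1 ≤ k) {g : K} (hσg : σ g = g) (hg : Valued.v g = Valued.v ϖ ^ (2 * t'))
    {eA : K} (hσeA : σ eA = eA) (heA1 : Valued.v eA = 1) {eB : K} (hσeB : σ eB = eB) (heB1 : Valued.v eB = 1) :
    eB * (ϖ * σ ϖ) ^ (t' + k) / (g * eA) = eB * (ϖ * σ ϖ) ^ (t' + k) / eA / g ∧
    σ (eB * (ϖ * σ ϖ) ^ (t' + k) / eA) = eB * (ϖ * σ ϖ) ^ (t' + k) / eA ∧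
    Valued.v (eB * (ϖ * σ ϖ) ^ (t' + k) / eA) = Valued.v ϖ ^ (2 * t') * Valued.v ϖ ^ (2 * k) ∧
    (normSign σ (eA * (1 + eB * (ϖ * σ ϖ) ^ (t' + k) / eA / g)) : ℚ) = normSign σ eA * normSign σ (1 + eB * (ϖ * σ ϖ) ^ (t' + k) / eA / g) ∧
    (normSign σ (g * eA * (1 + eB * (ϖ * σ ϖ) ^ (t' + k) / eA / g)) : ℚ) =
      normSign σ eA * (normSign σ g * normSign σ (1 + eB * (ϖ * σ ϖ) ^ (t' + k) / eA / g)) := by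
  haveI : Finite 𝓀[K] := Finite.of_fintype _
  obtain ⟨hσ, hvσ, hϖ, -, -, -, -⟩ := id hD
  obtain ⟨hϖ0, hϖ1⟩ := ne_zero_and_v_lt_one_of_v_eq_exp hϖ
  have hvϖ : 0 < Valued.v ϖ := (Valuation.pos_iff _).2 hϖ0
  have hπσ : ∀ m : ℕ, σ ((ϖ * σ ϖ) ^ m) = (ϖ * σ ϖ) ^ m := fun m => by rw [map_pow, map_mul, hσ, mul_comm]
  have hvπ : ∀ m : ℕ, Valued.v ((ϖ * σ ϖ) ^ m) = Valued.v ϖ ^ (2 * m) := fun m => by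
    rw [map_pow, map_mul, hvσ, ← pow_two, ← pow_mul, mul_comm]
  have hg0 : g ≠ 0 := fun h => by rw [h, map_zero] at hg; exact (pow_ne_zero _ hvϖ.ne') hg.symm
  have heA0 : eA ≠ 0 := fun h => by rw [h, map_zero] at heA1; exact zero_ne_one heA1
  set C : K := eB * (ϖ * σ ϖ) ^ (t' + k) / eA with hCdef
  have hσC : σ C = C := by rw [hCdef, map_div₀, map_mul, hσeB, hπσ, hσeA]
  have hvC : Valued.v C = Valued.v ϖ ^ (2 * t') * Valued.v ϖ ^ (2 * k) := by
    rw [hCdef, map_div₀, map_mul, heB1, one_mul, heA1, div_one, hvπ, ← pow_add]; congr 1; ring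
  have hX : eB * (ϖ * σ ϖ) ^ (t' + k) / (g * eA) = C / g := by rw [hCdef, div_mul_eq_div_div_swap]
  have hvCg : Valued.v (C / g) = Valued.v ϖ ^ (2 * k) := by rw [map_div₀, hvC, hg, mul_div_cancel_left₀ _ (pow_ne_zero _ hvϖ.ne')]
  have hσCg : σ (C / g) = C / g := by rw [map_div₀, hσC, hσg]
  have h1 : Valued.v (1 + C / g) = 1 := Valued.v.map_one_add_of_lt (by rw [hvCg]; exact pow_lt_one₀ zero_le hϖ1 (by omega))
  have h10 : (1 : K) + C / g ≠ 0 := fun h0 => by rw [h0, map_zero] at h1; exact zero_ne_one h1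
  have hσ1 : σ (1 + C / g) = 1 + C / g := by rw [map_add, map_one, hσCg]
  refine ⟨hX, hσC, hvC, by exact_mod_cast normSign_mul_of_fixed hD hσeA hσ1 heA0 h10, ?_⟩
  rw [show g * eA * (1 + C / g) = eA * (g * (1 + C / g)) by ring,
    normSign_mul_of_fixed hD hσeA (by rw [map_mul, hσg, hσ1]) heA0 (mul_ne_zero hg0 h10), normSign_mul_of_fixed hD hσg hσ1 hg0 h10]
  push_cast; ring

/-! ## §2  The class sums, slot by slot -/

section ClassSums

omit [CompleteSpace K] in
/-- Shared data of the class sums: the weight of every representative and the mass∕cardinality arithmetic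
`|𝒯-orbit|·w = q^{2ρ+2t′−⌈(ρ+2t′+1)∕2⌉+…}`, `|𝒯-orbit|·w·#R = (q−1)q^{2ρ+t′−1}`, `|𝒯-orbit|·w·q^{⌈ρ∕2⌉−1}… = q^{2ρ+t′−1}` (★ `stabiliserWeight_latt_glued_tube_eq`, ★ `orbit_mass_eq_pow`).
[cite: Kottwitz1986BaseChangeUnits, §1 pp. 240–241] [cite: Rogawski1990, §4.9 Prop. 4.9.1 (a) p. 55] -/
theorem mass_arith (hD : IsRamifiedQuadraticDatum σ ϖ d t) {ρ : ℕ} (hρ : 1 ≤ ρ) (t' : ℕ)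
    (R : Finset K) (hR1' : ∀ g ∈ R, σ g = g ∧ Valued.v g = Valued.v ϖ ^ (2 * t'))
    (hRcard : R.card = (Nat.card 𝓀[K] - 1) * Nat.card 𝓀[K] ^ ((ρ + 1) / 2 - 1))
    (V₀ : K → GL (Fin 3) K) (hV₀ : ∀ g, (V₀ g : Matrix (Fin 3) (Fin 3) K) = !![1, 0, 0; 1, ϖ ^ ρ, 0; 1 * 1 + g, ϖ ^ ρ * 1, ϖ ^ (2 * ρ + 2 * t')]) :
    (∀ g ∈ R, stabiliserWeight σ (latt (V₀ g : Matrix (Fin 3) (Fin 3) K)) =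
      ((((Nat.card 𝓀[K] - 1) * Nat.card 𝓀[K] ^ ((ρ + 2 * t' + 1) / 2 - 1)) * ((Nat.card 𝓀[K] - 1) * Nat.card 𝓀[K] ^ (ρ - 1)) : ℕ) : ℚ)⁻¹) ∧
    (∀ x : ℚ, ((((Nat.card 𝓀[K] - 1) * Nat.card 𝓀[K] ^ (ρ + 2 * t' - 1)) * ((Nat.card 𝓀[K] - 1) * Nat.card 𝓀[K] ^ (2 * ρ - 1)) : ℕ) : ℚ) *
        (((((Nat.card 𝓀[K] - 1) * Nat.card 𝓀[K] ^ ((ρ + 2 * t' + 1) / 2 - 1)) * ((Nat.card 𝓀[K] - 1) * Nat.card 𝓀[K] ^ (ρ - 1)) : ℕ) : ℚ)⁻¹ * x) =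
      (Nat.card 𝓀[K] : ℚ) ^ (2 * ρ + 2 * t' - (ρ + 2 * t' + 1) / 2) * x) ∧
    (Nat.card 𝓀[K] : ℚ) ^ (2 * ρ + 2 * t' - (ρ + 2 * t' + 1) / 2) * (R.card : ℚ) = ((Nat.card 𝓀[K] : ℚ) - 1) * (Nat.card 𝓀[K] : ℚ) ^ (2 * ρ - 1 + t') ∧
    (Nat.card 𝓀[K] : ℚ) ^ (2 * ρ + 2 * t' - (ρ + 2 * t' + 1) / 2) * (Nat.card 𝓀[K] : ℚ) ^ ((ρ + 1) / 2 - 1) = (Nat.card 𝓀[K] : ℚ) ^ (2 * ρ - 1 + t') := by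
  haveI : Finite 𝓀[K] := Finite.of_fintype _
  obtain ⟨hσ, hvσ, hϖ, hfix, hdd, -, -⟩ := id hD
  have hq1 : 1 < Nat.card 𝓀[K] := Finite.one_lt_card
  have h11 : Valued.v (1 : K) = 1 := map_one _
  have hw : ∀ g ∈ R, stabiliserWeight σ (latt (V₀ g : Matrix (Fin 3) (Fin 3) K)) =
      ((((Nat.card 𝓀[K] - 1) * Nat.card 𝓀[K] ^ ((ρ + 2 * t' + 1) / 2 - 1)) * ((Nat.card 𝓀[K] - 1) * Nat.card 𝓀[K] ^ (ρ - 1)) : ℕ) : ℚ)⁻¹ := fun g hg =>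
    stabiliserWeight_latt_glued_tube_eq hσ hvσ hfix hϖ hdd hρ t' h11 h11 (hR1' g hg).2 (V₀ g) (hV₀ g) (hR1' g hg).1
      (by rw [map_one, (hR1' g hg).1, one_mul, sub_self, map_zero]; exact zero_le)
  have hmass := orbit_mass_eq_pow hq1 hρ t'
  have hj : (ρ + 2 * t' + 1) / 2 = (ρ + 1) / 2 + t' := by
    rw [show ρ + 2 * t' + 1 = ρ + 1 + t' * 2 by ring, Nat.add_mul_div_right _ _ (by norm_num : 0 < 2)]
  have e1 : 2 * ρ + 2 * t' - (ρ + 2 * t' + 1) / 2 + ((ρ + 1) / 2 - 1) = 2 * ρ - 1 + t' := by rw [hj]; omega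
  have epow : (Nat.card 𝓀[K] : ℚ) ^ (2 * ρ + 2 * t' - (ρ + 2 * t' + 1) / 2) * (Nat.card 𝓀[K] : ℚ) ^ ((ρ + 1) / 2 - 1) =
      (Nat.card 𝓀[K] : ℚ) ^ (2 * ρ - 1 + t') := by rw [← pow_add, e1]
  have hRcardQ : (R.card : ℚ) = ((Nat.card 𝓀[K] : ℚ) - 1) * (Nat.card 𝓀[K] : ℚ) ^ ((ρ + 1) / 2 - 1) := by
    rw [hRcard]; push_cast [Nat.cast_sub hq1.le]; ring
  refine ⟨hw, fun x => by rw [← mul_assoc, hmass], ?_, epow⟩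
  rw [hRcardQ, mul_left_comm, epow]

variable (h2 : Valued.v (2 : K) < 1) (hD : IsRamifiedQuadraticDatum σ ϖ d t) (hE : IsElementDatum σ ϖ N₀ α β n₁ n₂ n₃) (hmc : mcOfRecord d ≤ N₀)
  (T : GL (Fin 3) K) (hT : (T : Matrix (Fin 3) (Fin 3) K) = Matrix.diagonal ![α, β, 1]) (ρ t' : ℕ) (hρ : 1 ≤ ρ) (ht' : 1 ≤ t')
  (hloc : 2 * ρ + d % 2 = n₂) (k : ℕ) (hk : 1 ≤ k) (hk₁ : 2 * (ρ + t' + k) + d % 2 = n₁)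
  {eA : K} (hσeA : σ eA = eA) (heA1 : Valued.v eA = 1)
  (heA : Valued.v ((ϖ ^ (d % 2 + 2 * d - 1))⁻¹ * ((α - 1) * ((ϖ * σ ϖ) ^ ρ)⁻¹ - eA * ((ϖ - σ ϖ) * ((ϖ * σ ϖ) ^ ((d - d % 2) / 2))⁻¹))) ≤ 1)
  {eB : K} (hσeB : σ eB = eB) (heB1 : Valued.v eB = 1)
  (heB : Valued.v ((ϖ ^ (d % 2 + 2 * d - 1))⁻¹ * ((β - 1) * ((ϖ * σ ϖ) ^ (ρ + t' + k))⁻¹ - eB * ((ϖ - σ ϖ) * ((ϖ * σ ϖ) ^ ((d - d % 2) / 2))⁻¹))) ≤ 1)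
  (R : Finset K) (hR1' : ∀ g ∈ R, σ g = g ∧ Valued.v g = Valued.v ϖ ^ (2 * t'))
  (hR2' : ∀ f : K, σ f = f → Valued.v f = Valued.v ϖ ^ (2 * t') → ∃ g ∈ R, Valued.v (f - g) ≤ Valued.v ϖ ^ (ρ + 2 * t'))
  (hR3' : ∀ g ∈ R, ∀ g' ∈ R, Valued.v (g - g') ≤ Valued.v ϖ ^ (ρ + 2 * t') → g = g')
  (hRcard : R.card = (Nat.card 𝓀[K] - 1) * Nat.card 𝓀[K] ^ ((ρ + 1) / 2 - 1))
  (V₀ : K → GL (Fin 3) K) (hV₀ : ∀ g, (V₀ g : Matrix (Fin 3) (Fin 3) K) = !![1, 0, 0; 1, ϖ ^ ρ, 0; 1 * 1 + g, ϖ ^ ρ * 1, ϖ ^ (2 * ρ + 2 * t')])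
include h2 hD hE hmc hT hρ ht' hloc hk hk₁ hσeA heA1 heA hσeB heB1 heB hR1' hR2' hR3' hRcard hV₀

/-- **SLOT `0` (the own slot of tower 1)**: `|𝒯-orbit| · Σ_{g ∈ R} value₀(latt V(1,1,g)) = ω(e_A)∕2 · q^{2ρ−1+t′} · ((q−1)·[2d + ℓ₀ + 2ρ + 2t′ ≤ n₁] − [n₁ + 2 = 2d + ℓ₀ + 2ρ + 2t′])`
— `ω(e_A(1 + C∕g)) = ω(e_A)·ω(1 + C∕g)` and ★ p861882's three sums (`2k = n₁ − n₂ − 2t′`: deep `2d ≤ 2k` ∕ boundary `k + 1 = d` ∕ below, the window `2d ≤ ρ+2k+1` being the indicator).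
[cite: Rogawski1990, §4.9 Prop. 4.9.1 (b) p. 55] [cite: Serre1979, Ch. V §3 Prop. 5, Cor. 3; Ch. XV §2] [cite: LanglandsShelstad1987, §3] -/
theorem card_mul_sum_value_zero_eq :
    ((((Nat.card 𝓀[K] - 1) * Nat.card 𝓀[K] ^ (ρ + 2 * t' - 1)) * ((Nat.card 𝓀[K] - 1) * Nat.card 𝓀[K] ^ (2 * ρ - 1)) : ℕ) : ℚ) *
        ∑ g ∈ R, (labelledOddCount σ ϖ 0 0 (valueClassLabel σ ϖ (α - 1) (β - 1) (d % 2 + 2 * d - 1) d) (latt (V₀ g : Matrix (Fin 3) (Fin 3) K)) : ℚ) /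
            ((((unitStabilizer (latt (V₀ g : Matrix (Fin 3) (Fin 3) K))).map (unitNormMap σ 3)).relIndex (fixedUnitTorus σ 3) : ℕ) : ℚ) =
      (normSign σ eA : ℚ) / 2 * (Nat.card 𝓀[K] : ℚ) ^ (2 * ρ - 1 + t') *
        ((if 2 * d + d % 2 + 2 * ρ + 2 * t' ≤ n₁ then (Nat.card 𝓀[K] : ℚ) - 1 else 0) - (if n₁ + 2 = 2 * d + d % 2 + 2 * ρ + 2 * t' then 1 else 0)) := by
  classical
  haveI : Finite 𝓀[K] := Finite.of_fintype _
  have hd2 : 2 ≤ d := two_le_d_of_v_two_lt_one hD h2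
  obtain ⟨hw, key, hcardR, epow⟩ := mass_arith hD hρ t' R hR1' hRcard V₀ hV₀
  obtain ⟨hσC, hvC⟩ := charConst_tokens hD t' k hσeA heA1 hσeB heB1
  have hterm : ∀ g ∈ R, (labelledOddCount σ ϖ 0 0 (valueClassLabel σ ϖ (α - 1) (β - 1) (d % 2 + 2 * d - 1) d) (latt (V₀ g : Matrix (Fin 3) (Fin 3) K)) : ℚ) /
        ((((unitStabilizer (latt (V₀ g : Matrix (Fin 3) (Fin 3) K))).map (unitNormMap σ 3)).relIndex (fixedUnitTorus σ 3) : ℕ) : ℚ) =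
      ((((Nat.card 𝓀[K] - 1) * Nat.card 𝓀[K] ^ ((ρ + 2 * t' + 1) / 2 - 1)) * ((Nat.card 𝓀[K] - 1) * Nat.card 𝓀[K] ^ (ρ - 1)) : ℕ) : ℚ)⁻¹ *
        ((normSign σ eA : ℚ) / 2 * ((if 2 * d ≤ ρ + 2 * k + 1 then 1 else 0 : ℤ) : ℚ) *
          ((normSign σ (1 + eB * (ϖ * σ ϖ) ^ (t' + k) / eA / g) : ℤ) : ℚ)) := by
    intro g hg
    obtain ⟨hX, -, -, hωA, -⟩ := orbitChar_tokens hD (t' := t') hk (hR1' g hg).1 (hR1' g hg).2 hσeA heA1 hσeB heB1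
    rw [(value_latt_glued_rep_kappaLocus_eq h2 hD hE hmc T hT ρ t' hρ ht' hloc k hk hk₁ (hR1' g hg).1 (hR1' g hg).2 (V₀ g) (hV₀ g)
      hσeA heA1 heA hσeB heB1 heB).1, hX, hωA, hw g hg]
    ring
  rw [Finset.sum_congr rfl hterm, ← Finset.mul_sum, ← Finset.mul_sum, key, ← Int.cast_sum]
  by_cases hdeep : 2 * d ≤ 2 * k
  · rw [sum_normSign_one_add_div_eq_card hD (by omega) R hR1' hσC hvC, if_pos (by omega : 2 * d ≤ ρ + 2 * k + 1),
      if_pos (by omega : 2 * d + d % 2 + 2 * ρ + 2 * t' ≤ n₁), if_neg (by omega : ¬ (n₁ + 2 = 2 * d + d % 2 + 2 * ρ + 2 * t'))]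
    push_cast
    rw [show (Nat.card 𝓀[K] : ℚ) ^ (2 * ρ + 2 * t' - (ρ + 2 * t' + 1) / 2) * ((normSign σ eA : ℚ) / 2 * 1 * (R.card : ℚ)) =
      (normSign σ eA : ℚ) / 2 * ((Nat.card 𝓀[K] : ℚ) ^ (2 * ρ + 2 * t' - (ρ + 2 * t' + 1) / 2) * (R.card : ℚ)) by ring, hcardR]
    ring
  · by_cases hbd : k + 1 = d
    · rw [sum_normSign_one_add_div_boundary hD h2 hρ hk hbd R hR1' hR2' hR3' hσC hvC, if_pos (by omega : 2 * d ≤ ρ + 2 * k + 1),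
        if_neg (by omega : ¬ (2 * d + d % 2 + 2 * ρ + 2 * t' ≤ n₁)), if_pos (by omega : n₁ + 2 = 2 * d + d % 2 + 2 * ρ + 2 * t')]
      push_cast
      rw [show (Nat.card 𝓀[K] : ℚ) ^ (2 * ρ + 2 * t' - (ρ + 2 * t' + 1) / 2) * ((normSign σ eA : ℚ) / 2 * 1 * -((Nat.card 𝓀[K] : ℚ) ^ ((ρ + 1) / 2 - 1))) =
        -((normSign σ eA : ℚ) / 2) * ((Nat.card 𝓀[K] : ℚ) ^ (2 * ρ + 2 * t' - (ρ + 2 * t' + 1) / 2) * (Nat.card 𝓀[K] : ℚ) ^ ((ρ + 1) / 2 - 1)) by ring, epow]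
      ring
    · rw [if_neg (by omega : ¬ (2 * d + d % 2 + 2 * ρ + 2 * t' ≤ n₁)), if_neg (by omega : ¬ (n₁ + 2 = 2 * d + d % 2 + 2 * ρ + 2 * t'))]
      by_cases hwin : 2 * d ≤ ρ + 2 * k + 1
      · rw [sum_normSign_one_add_div_eq_zero hD h2 hk (by omega) hwin R hR1' hR2' hR3' hσC hvC]
        simp
      · rw [if_neg hwin]
        simp

/-- **SLOT `1`**: `|𝒯-orbit| · Σ_{g ∈ R} value₁(latt V(1,1,g)) = 0` — in the window `2d ≤ ρ+1`, `ω(g·e_A(1 + C∕g)) = ω(e_A)·ω(g)·ω(1 + C∕g)` and ★ p861882 `Σ ω(g)ω(1 + C∕g) = 0`;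
outside it the indicator vanishes. [cite: Rogawski1990, §4.9 Prop. 4.9.1 (b) p. 55] [cite: Serre1979, Ch. V §3 Cor. 3; Ch. XV §2] [cite: LanglandsShelstad1987, §3] -/
theorem card_mul_sum_value_one_eq :
    ((((Nat.card 𝓀[K] - 1) * Nat.card 𝓀[K] ^ (ρ + 2 * t' - 1)) * ((Nat.card 𝓀[K] - 1) * Nat.card 𝓀[K] ^ (2 * ρ - 1)) : ℕ) : ℚ) *
        ∑ g ∈ R, (labelledOddCount σ ϖ 0 1 (valueClassLabel σ ϖ (α - 1) (β - 1) (d % 2 + 2 * d - 1) d) (latt (V₀ g : Matrix (Fin 3) (Fin 3) K)) : ℚ) /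
            ((((unitStabilizer (latt (V₀ g : Matrix (Fin 3) (Fin 3) K))).map (unitNormMap σ 3)).relIndex (fixedUnitTorus σ 3) : ℕ) : ℚ) = 0 := by
  classical
  haveI : Finite 𝓀[K] := Finite.of_fintype _
  obtain ⟨hw, key, -, -⟩ := mass_arith hD hρ t' R hR1' hRcard V₀ hV₀
  obtain ⟨hσC, hvC⟩ := charConst_tokens hD t' k hσeA heA1 hσeB heB1
  by_cases hwin : 2 * d ≤ ρ + 1
  · have hterm : ∀ g ∈ R, (labelledOddCount σ ϖ 0 1 (valueClassLabel σ ϖ (α - 1) (β - 1) (d % 2 + 2 * d - 1) d) (latt (V₀ g : Matrix (Fin 3) (Fin 3) K)) : ℚ) /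
          ((((unitStabilizer (latt (V₀ g : Matrix (Fin 3) (Fin 3) K))).map (unitNormMap σ 3)).relIndex (fixedUnitTorus σ 3) : ℕ) : ℚ) =
        ((((Nat.card 𝓀[K] - 1) * Nat.card 𝓀[K] ^ ((ρ + 2 * t' + 1) / 2 - 1)) * ((Nat.card 𝓀[K] - 1) * Nat.card 𝓀[K] ^ (ρ - 1)) : ℕ) : ℚ)⁻¹ *
          ((normSign σ eA : ℚ) / 2 * ((normSign σ g * normSign σ (1 + eB * (ϖ * σ ϖ) ^ (t' + k) / eA / g) : ℤ) : ℚ)) := by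
      intro g hg
      obtain ⟨hX, -, -, -, hωgA⟩ := orbitChar_tokens hD (t' := t') hk (hR1' g hg).1 (hR1' g hg).2 hσeA heA1 hσeB heB1
      rw [(value_latt_glued_rep_kappaLocus_eq h2 hD hE hmc T hT ρ t' hρ ht' hloc k hk hk₁ (hR1' g hg).1 (hR1' g hg).2 (V₀ g) (hV₀ g)
        hσeA heA1 heA hσeB heB1 heB).2.1, hX, hωgA, hw g hg, if_pos hwin]
      push_cast; ring
    rw [Finset.sum_congr rfl hterm, ← Finset.mul_sum, ← Finset.mul_sum, key, ← Int.cast_sum,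
      sum_normSign_mul_normSign_one_add_div_eq_zero hD h2 hwin hk R hR1' hR2' hR3' hσC hvC]
    simp
  · rw [Finset.sum_congr rfl (fun g hg => by
      rw [(value_latt_glued_rep_kappaLocus_eq h2 hD hE hmc T hT ρ t' hρ ht' hloc k hk hk₁ (hR1' g hg).1 (hR1' g hg).2 (V₀ g) (hV₀ g)
        hσeA heA1 heA hσeB heB1 heB).2.1, if_neg hwin])]
    simp

/-- **SLOT `2`**: `|𝒯-orbit| · Σ_{g ∈ R} value₂(latt V(1,1,g)) = 0` — in the window `2d ≤ ρ+1`, `ω(g·e_A(1 + C∕g))·ω(−1)ω(1+g) = ω(−1)ω(e_A)·ω(g)ω(1+g)ω(1 + C∕g)` and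
★ p861882 `Σ ω(g)ω(1+g)ω(1 + C∕g) = 0`; outside it the indicator vanishes. [cite: Rogawski1990, §4.9 Prop. 4.9.1 (b) p. 55] [cite: Serre1979, Ch. V §3 Cor. 3; Ch. XV §2]
[cite: LanglandsShelstad1987, §3] -/
theorem card_mul_sum_value_two_eq :
    ((((Nat.card 𝓀[K] - 1) * Nat.card 𝓀[K] ^ (ρ + 2 * t' - 1)) * ((Nat.card 𝓀[K] - 1) * Nat.card 𝓀[K] ^ (2 * ρ - 1)) : ℕ) : ℚ) *
        ∑ g ∈ R, (labelledOddCount σ ϖ 0 2 (valueClassLabel σ ϖ (α - 1) (β - 1) (d % 2 + 2 * d - 1) d) (latt (V₀ g : Matrix (Fin 3) (Fin 3) K)) : ℚ) /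
            ((((unitStabilizer (latt (V₀ g : Matrix (Fin 3) (Fin 3) K))).map (unitNormMap σ 3)).relIndex (fixedUnitTorus σ 3) : ℕ) : ℚ) = 0 := by
  classical
  haveI : Finite 𝓀[K] := Finite.of_fintype _
  obtain ⟨hw, key, -, -⟩ := mass_arith hD hρ t' R hR1' hRcard V₀ hV₀
  obtain ⟨hσC, hvC⟩ := charConst_tokens hD t' k hσeA heA1 hσeB heB1
  by_cases hwin : 2 * d ≤ ρ + 1
  · have hterm : ∀ g ∈ R, (labelledOddCount σ ϖ 0 2 (valueClassLabel σ ϖ (α - 1) (β - 1) (d % 2 + 2 * d - 1) d) (latt (V₀ g : Matrix (Fin 3) (Fin 3) K)) : ℚ) /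
          ((((unitStabilizer (latt (V₀ g : Matrix (Fin 3) (Fin 3) K))).map (unitNormMap σ 3)).relIndex (fixedUnitTorus σ 3) : ℕ) : ℚ) =
        ((((Nat.card 𝓀[K] - 1) * Nat.card 𝓀[K] ^ ((ρ + 2 * t' + 1) / 2 - 1)) * ((Nat.card 𝓀[K] - 1) * Nat.card 𝓀[K] ^ (ρ - 1)) : ℕ) : ℚ)⁻¹ *
          ((normSign σ (-1 : K) : ℚ) * (normSign σ eA : ℚ) / 2 *
            ((normSign σ g * normSign σ (1 + g) * normSign σ (1 + eB * (ϖ * σ ϖ) ^ (t' + k) / eA / g) : ℤ) : ℚ)) := by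
      intro g hg
      obtain ⟨hX, -, -, -, hωgA⟩ := orbitChar_tokens hD (t' := t') hk (hR1' g hg).1 (hR1' g hg).2 hσeA heA1 hσeB heB1
      rw [(value_latt_glued_rep_kappaLocus_eq h2 hD hE hmc T hT ρ t' hρ ht' hloc k hk hk₁ (hR1' g hg).1 (hR1' g hg).2 (V₀ g) (hV₀ g)
        hσeA heA1 heA hσeB heB1 heB).2.2, hX, hωgA, hw g hg, if_pos hwin]
      push_cast; ring
    rw [Finset.sum_congr rfl hterm, ← Finset.mul_sum, ← Finset.mul_sum, key, ← Int.cast_sum,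
      sum_normSign_mul_normSign_one_add_mul_normSign_one_add_div_eq_zero hD h2 hwin ht' hk R hR1' hR2' hR3' hσC hvC]
    simp
  · rw [Finset.sum_congr rfl (fun g hg => by
      rw [(value_latt_glued_rep_kappaLocus_eq h2 hD hE hmc T hT ρ t' hρ ht' hloc k hk hk₁ (hR1' g hg).1 (hR1' g hg).2 (V₀ g) (hV₀ g)
        hσeA heA1 heA hσeB heB1 heB).2.2, if_neg hwin])]
    simp

end ClassSums

/-! ## §3  THE HEAD `hκ₁` -/

/-- **β-BOARD R6a — THE TOWER-1 κ-CLASS STRATUM HEAD `hκ₁`.**  At a ramified datum (`|2| < 1`), an element datum at `n0DerivedOfRecord d`, `T = diag(α, β, 1)`, and tower-sign tokens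
`e_A` of `α − 1` (depth letter `n₂`) and `e_B` of `β − 1` (depth letter `n₁`): for all `ρ, s ≥ 1` with `2 ∣ s`, on the κ-branch `2ρ + d%2 = n₂`, `2ρ + s + d%2 < n₁`, and every slot `i`,
`Σᶠ_{M ∈ stratum (2ρ, 2ρ+s, 2ρ+s), shell} labelledOddCount σ ϖ 0 i Λ M ∕ [𝒰 : N(S̃′(M))] = (ω(e_A), 0, 0)_i ∕ 2 · q^{2ρ−1+s∕2} · ((q−1)·[2d + d%2 + 2ρ + s ≤ n₁] − [n₁ + 2 = 2d + d%2 + 2ρ + s])`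
— the `hκ` binder of ★ p861954 `kappaLine_G1_of_rows` VERBATIM (§2 over ★ FILE E1's decomposition, ★ (iv-c) representatives). [cite: Kottwitz1986BaseChangeUnits, §1 pp. 240–241]
[cite: Rogawski1990, §4.9 Prop. 4.9.1 (a)(b) p. 55, §4.10 p. 58] [cite: LanglandsShelstad1987, §3] [cite: Serre1979, Ch. V §3, Ch. XV §2] -/
theorem finsum_stratum_G1_kappaLocus_shell_labelledOdd_div_relIndex_eq (hD : IsRamifiedQuadraticDatum σ ϖ d t) (h2 : Valued.v (2 : K) < 1)
    (hE : IsElementDatum σ ϖ (n0DerivedOfRecord d) α β n₁ n₂ n₃)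
    (T : GL (Fin 3) K) (hT : (T : Matrix (Fin 3) (Fin 3) K) = Matrix.diagonal ![α, β, 1])
    {eA eB : K} (hσeA : σ eA = eA) (heA1 : Valued.v eA = 1)
    (heA : Valued.v ((ϖ ^ mstarOfRecord d)⁻¹ * ((α - 1) * ((ϖ * σ ϖ) ^ ((n₂ - d % 2) / 2))⁻¹ - eA * ((ϖ - σ ϖ) * ((ϖ * σ ϖ) ^ ((d - d % 2) / 2))⁻¹))) ≤ 1)
    (hσeB : σ eB = eB) (heB1 : Valued.v eB = 1)
    (heB : Valued.v ((ϖ ^ mstarOfRecord d)⁻¹ * ((β - 1) * ((ϖ * σ ϖ) ^ ((n₁ - d % 2) / 2))⁻¹ - eB * ((ϖ - σ ϖ) * ((ϖ * σ ϖ) ^ ((d - d % 2) / 2))⁻¹))) ≤ 1) :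
    ∀ (ρ s : ℕ), 1 ≤ ρ → 1 ≤ s → 2 ∣ s → 2 * ρ + d % 2 = n₂ → 2 * ρ + s + d % 2 < n₁ → ∀ i : Fin 3,
      ∑ᶠ M ∈ {M : Submodule 𝒪[K] (Fin 3 → K) | M ∈ stratum σ ϖ T ![2 * ρ, 2 * ρ + s, 2 * ρ + s] ∧
          (LatticeInLevel ϖ (d % 2) (Matrix.diagonal ![α - 1, β - 1, 0]) M ∧ ¬ LatticeInLevel ϖ (d % 2 + 1) (Matrix.diagonal ![α - 1, β - 1, 0]) M ∧
            LatticeInLevel ϖ (mcOfRecord d) (Matrix.diagonal ![(α - 1) * (α - 1), (β - 1) * (β - 1), 0]) M)},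
        (labelledOddCount σ ϖ 0 i (valueClassLabel σ ϖ (α - 1) (β - 1) (mstarOfRecord d) d) M : ℚ) /
          ((((unitStabilizer M).map (unitNormMap σ 3)).relIndex (fixedUnitTorus σ 3) : ℕ) : ℚ) =
        ((![normSign σ eA, 0, 0] : Fin 3 → ℤ) i : ℚ) / 2 * (Fintype.card 𝓀[K] : ℚ) ^ (2 * ρ - 1 + s / 2) *
          ((if 2 * d + d % 2 + 2 * ρ + s ≤ n₁ then (Fintype.card 𝓀[K] : ℚ) - 1 else 0) - (if n₁ + 2 = 2 * d + d % 2 + 2 * ρ + s then 1 else 0)) := by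
  intro ρ s hρ hs hpar hloc hgt i
  classical
  haveI : Finite 𝓀[K] := Finite.of_fintype _
  obtain ⟨hσ, hvσ, hϖ, hfix, hdd, hd1, -⟩ := id hD
  obtain ⟨hϖ0, -⟩ := ne_zero_and_v_lt_one_of_v_eq_exp hϖ
  have hmcN : mcOfRecord d ≤ n0DerivedOfRecord d := mcOfRecord_le_n0DerivedOfRecord d
  have hmcv : mcOfRecord d = 2 * ((d % 2 + 2 * d - 1 + d) / 2) := rfl
  have hdN : d ≤ n0DerivedOfRecord d := by omega
  have hmsv : mstarOfRecord d = d % 2 + 2 * d - 1 := rfl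
  rw [hmsv] at heA heB ⊢
  obtain ⟨hp1, -, -⟩ := depth_mod_two_eq_of_isElementDatum hD hE hdN
  obtain ⟨t', rfl⟩ := hpar
  have ht' : 1 ≤ t' := by omega
  obtain ⟨k, hk₁⟩ : ∃ k : ℕ, 2 * (ρ + t' + k) + d % 2 = n₁ := ⟨(n₁ - d % 2) / 2 - ρ - t', by omega⟩
  have hk : 1 ≤ k := by omega
  have hjA : (n₂ - d % 2) / 2 = ρ := by omega
  have hjB : (n₁ - d % 2) / 2 = ρ + t' + k := by omega
  rw [hjA] at heA
  rw [hjB] at heB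
  rw [show 2 * ρ - 1 + 2 * t' / 2 = 2 * ρ - 1 + t' by omega, ← Nat.card_eq_fintype_card]
  -- the class representatives and the reference frames
  obtain ⟨R₀, hR₀fin, hR₀card, hR1, hR2, hR3⟩ := exists_fixed_class_representatives hσ hvσ hfix hϖ hdd ρ t' hρ
  set R : Finset K := hR₀fin.toFinset with hRdef
  have hmemR : ∀ g, g ∈ R ↔ g ∈ R₀ := fun g => Set.Finite.mem_toFinset hR₀fin
  have hRcard : R.card = (Nat.card 𝓀[K] - 1) * Nat.card 𝓀[K] ^ ((ρ + 1) / 2 - 1) := by rw [hRdef, ← Set.ncard_eq_toFinset_card R₀ hR₀fin]; exact hR₀card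
  have hR1' : ∀ g ∈ R, σ g = g ∧ Valued.v g = Valued.v ϖ ^ (2 * t') := fun g hg => hR1 g ((hmemR g).1 hg)
  have hR2' : ∀ f : K, σ f = f → Valued.v f = Valued.v ϖ ^ (2 * t') → ∃ g ∈ R, Valued.v (f - g) ≤ Valued.v ϖ ^ (ρ + 2 * t') :=
    fun f hσf hvf => by obtain ⟨g, hg, h⟩ := hR2 f hσf hvf; exact ⟨g, (hmemR g).2 hg, h⟩
  have hR3' : ∀ g ∈ R, ∀ g' ∈ R, Valued.v (g - g') ≤ Valued.v ϖ ^ (ρ + 2 * t') → g = g' :=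
    fun g hg g' hg' h => hR3 g ((hmemR g).1 hg) g' ((hmemR g').1 hg') h
  choose V₀ hV₀ using fun g : K => exists_gl_coe_eq_glued (1 : K) 1 g (pow_ne_zero ρ hϖ0) (pow_ne_zero (2 * ρ + 2 * t') hϖ0)
  -- decomposition over the representatives, then the slots
  rw [finsum_kappaLocus_eq_card_mul_sum h2 hD hE hmcN T hT ρ t' hρ ht' hloc (by omega) R hR1' hR2' hR3' V₀ hV₀ (d % 2 + 2 * d - 1) i]
  fin_cases i
  · simp only [Fin.zero_eta, Fin.isValue, Matrix.cons_val_zero]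
    exact card_mul_sum_value_zero_eq h2 hD hE hmcN T hT ρ t' hρ ht' hloc k hk hk₁ hσeA heA1 heA hσeB heB1 heB R hR1' hR2' hR3' hRcard V₀ hV₀
  · simp only [Fin.mk_one, Fin.isValue, Matrix.cons_val_one, Matrix.cons_val_zero, Int.cast_zero, zero_div, zero_mul]
    exact card_mul_sum_value_one_eq h2 hD hE hmcN T hT ρ t' hρ ht' hloc k hk hk₁ hσeA heA1 heA hσeB heB1 heB R hR1' hR2' hR3' hRcard V₀ hV₀
  · simp only [Fin.reduceFinMk, Fin.isValue, Matrix.cons_val_two, Matrix.tail_cons, Matrix.head_cons, Int.cast_zero, zero_div, zero_mul]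
    exact card_mul_sum_value_two_eq h2 hD hE hmcN T hT ρ t' hρ ht' hloc k hk hk₁ hσeA heA1 heA hσeB heB1 heB R hR1' hR2' hR3' hRcard V₀ hV₀

end Summit.HodgeConjecture.HodgeConjecture.Cruxes.H413.F0P3cDyRamLabelledOddKappaClassG1

end
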